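import Summits.Ventures.LatticeQCDFlow.Exactness.IMHCoupledEstimatorReplicas
import HarnessLib

/-!
# The between-replica error bar of the coupled flow-MCMC estimator is honest: across `R` independent coupled pairs the printed
# squared standard error has expectation EXACTLY `Var(H̄)`, and the true mean-square error exceeds it by at most the squared
# truncation bias `((1 − A)^{k+N}(c − a))²` — no autocorrelation time, no window, no reference value

HONEST FRAMING: exact (Metropolis-corrected) sampling algorithms for lattice gauge theory;
figures of merit are autocorrelation/cost numbers at stated couplings and volumes; no
continuum-physics claim.

Venture `LatticeQCDFlow` (cell pub-lqcd), topic `Exactness`; FANOUT row 30 (lean-1, GEN-38).  NEW WORK of the cell,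
general state space; sequel to `Exactness/IMHCoupledEstimatorReplicas` (GEN-37, V4: `R` pairwise independent pair streams
`Z_j`, each distributed as the common-random-numbers pair chain `K̂` of `K = indepMH q w` from an initial coupling one update
ahead in its first coordinate; the coupled estimator `H(Z_j) = f(Y_k) + Σ_{n<N}(f(X′_{k+n}) − f(Y_{k+n}))`, `a ≤ f ≤ c` measurable;
`E(H̄ − π f)² ≤ [Var_π f + r^k(c − a)²(2W² + W + 1)]/R + (1 − 1/R)(r^{k+N}(c − a))²`, `W = w(x₀)`, `r = 1 − 1/W`) and to row 11's
`Scoring/ReplicaError` (the between-replica squared standard error `SE² = Σ_{j<R}(Y_j − Ȳ)²/(R(R − 1))` is unbiased for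
`Var(Ȳ)` when the replicas have equal means, conservative otherwise).  GEN-37 recorded «NOT CLAIMED: the between-replica
error ESTIMATOR».  It is typed here — what a seat PRINTS next to `H̄` is `SE²`, and for the coupled estimator that number is
certified:

* §1 (any common law of the pair streams) **`crnLag_replicas_integral_SEsq_eq`** — `R ≥ 2` pairwise independent, identically
  distributed pair streams: `E[SE²] = Var(H̄)` EXACTLY; **`crnLag_replicas_sq_eq_SEsq_add`** — for every target `m`,
  `E(H̄ − m)² = E[SE²] + (E H − m)²` EXACTLY (`E H` the common mean of one coupled estimate).
* §2 (the CRN pair chain from ONE initial coupling `ν̂` one update ahead) **`crnLag_replicas_mse_sub_SEsq_mem_Icc`** —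
  `E(H̄ − π f)² − E[SE²] ∈ [0, (r^{k+N}(c − a))²]`: THE PRINTED ERROR BAR IS HONEST UP TO THE SQUARED TRUNCATION BIAS (which is
  geometrically small in the lag `k + N` and absent from the fluctuation term) — contrast GEN-35's naive error bar of ONE run,
  optimistic by the integrated autocorrelation; **`crnLag_replicas_integral_SEsq_le`** — and it shrinks like `1/R` with the
  equilibrium constant: `E[SE²] ≤ [Var_π f + r^k(c − a)²(2W² + W + 1)]/R`; **`crnLag_replicas_chebyshev`** —
  `P(|H̄ − π f| ≥ s) ≤ (E[SE²] + (r^{k+N}(c − a))²)/s²`.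
* §3 (pair streams from DIFFERENT initial couplings `ν̂_j`, each one update ahead) **`crnLag_replicas_mse_le_SEsq_add`** —
  `E(H̄ − π f)² ≤ E[SE²] + (r^{k+N}(c − a))²`: with unequal starts the printed error bar is conservative for the fluctuation and
  the bias allowance is unchanged.
Reading (gauge files): run `R` independent coupled pairs of the exact gauge sampler, print the grand mean and the between-pair
standard error; the expected squared error bar equals the variance of the grand mean exactly, and the true mean-square error
about the target exceeds it by at most `((1 − A)^{k+N}(c − a))²` — an error bar with a certificate and without `τ_int`.
NOT CLAIMED: the sampling distribution of `SE²` (its own scatter; a Student-type interval needs a Gaussian model); coverage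
probabilities beyond Chebyshev; the `N = ∞` estimator; anything for unbounded `f` or any value of `A`.  No `sorry`, no new
definitions (`replicaMean`, `replicaSEsq` are row 11's), nothing cited as a fact.
-/

noncomputable section

namespace Summit.Ventures.LatticeQCDFlow.Exactness

open MeasureTheory ProbabilityTheory Function Finset
open scoped ENNReal unitInterval
open Summit.Ventures.LatticeQCDFlow.Scoring

variable {Ω : Type*} [MeasurableSpace Ω] {q : Measure Ω} [IsProbabilityMeasure q] {w : Ω → ℝ}

section Replicas

variable {Ω' : Type*} {mΩ' : MeasurableSpace Ω'} {μ : Measure Ω'} [IsProbabilityMeasure μ]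
  {Z : ℕ → Ω' → (ℕ → Ω × Ω)} {R : ℕ}

/-! ## §1 Identically distributed, pairwise independent pair streams: the printed error bar is unbiased for `Var(H̄)` -/

omit [IsProbabilityMeasure q] in
/-- **`E[SE²] = Var(H̄)` EXACTLY** for `R ≥ 2` pairwise independent pair streams with a common law `P` (any law on pair-path space)
and the coupled estimator `H(z) = f((z k).2) + Σ_{n<N}(f((z(k+n)).1) − f((z(k+n)).2))`, `a ≤ f ≤ c` measurable. [ours] -/
theorem crnLag_replicas_integral_SEsq_eq (hR : 2 ≤ R) {f : Ω → ℝ} (hf : Measurable f) {a c : ℝ} (ha : ∀ x, a ≤ f x)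
    (hc : ∀ x, f x ≤ c) (k N : ℕ) (hZm : ∀ j, Measurable (Z j)) {P : Measure (ℕ → Ω × Ω)}
    (hlaw : ∀ j < R, μ.map (Z j) = P) (hind : ∀ i < R, ∀ j < R, i ≠ j → IndepFun (Z i) (Z j) μ) :
    μ[replicaSEsq (fun j ω => f ((Z j ω k).2) + ∑ n ∈ range N, (f ((Z j ω (k + n)).1) - f ((Z j ω (k + n)).2))) R] =
      Var[replicaMean (fun j ω => f ((Z j ω k).2) + ∑ n ∈ range N, (f ((Z j ω (k + n)).1) - f ((Z j ω (k + n)).2))) R; μ] := by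
  have hHm : Measurable fun z : ℕ → Ω × Ω => f ((z k).2) + ∑ n ∈ range N, (f ((z (k + n)).1) - f ((z (k + n)).2)) :=
    measurable_crnLagEstimator hf k N
  have hY2 : ∀ j < R, MemLp (fun ω => f ((Z j ω k).2) + ∑ n ∈ range N, (f ((Z j ω (k + n)).1) - f ((Z j ω (k + n)).2))) 2 μ :=
    fun j _ => memLp_crnLag_replica hf ha hc k N hZm j
  have hcov : ∀ i < R, ∀ j < R, i ≠ j →
      cov[fun ω => f ((Z i ω k).2) + ∑ n ∈ range N, (f ((Z i ω (k + n)).1) - f ((Z i ω (k + n)).2)),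
        fun ω => f ((Z j ω k).2) + ∑ n ∈ range N, (f ((Z j ω (k + n)).1) - f ((Z j ω (k + n)).2)); μ] = 0 :=
    fun i hi j hj hij => ((hind i hi j hj hij).comp hHm hHm).covariance_eq_zero (hY2 i hi) (hY2 j hj)
  have hmean : ∀ j < R, μ[fun ω => f ((Z j ω k).2) + ∑ n ∈ range N, (f ((Z j ω (k + n)).1) - f ((Z j ω (k + n)).2))] =
      ∫ z, (f ((z k).2) + ∑ n ∈ range N, (f ((z (k + n)).1) - f ((z (k + n)).2))) ∂P := fun j hj =>
    integral_comp_eq_of_map_eq (hZm j) (hlaw j hj) hHm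
  exact integral_replicaSEsq_of_means_eq hR hY2 hcov hmean

omit [IsProbabilityMeasure q] in
/-- **`E(H̄ − m)² = E[SE²] + (E H − m)²` EXACTLY** for every target `m`, in the setting of `crnLag_replicas_integral_SEsq_eq`
(`E H = ∫ H dP` the common mean of one coupled estimate). [ours] -/
theorem crnLag_replicas_sq_eq_SEsq_add (hR : 2 ≤ R) {f : Ω → ℝ} (hf : Measurable f) {a c : ℝ} (ha : ∀ x, a ≤ f x)
    (hc : ∀ x, f x ≤ c) (k N : ℕ) (hZm : ∀ j, Measurable (Z j)) {P : Measure (ℕ → Ω × Ω)}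
    (hlaw : ∀ j < R, μ.map (Z j) = P) (hind : ∀ i < R, ∀ j < R, i ≠ j → IndepFun (Z i) (Z j) μ) (m : ℝ) :
    ∫ ω, (replicaMean (fun j ω => f ((Z j ω k).2) + ∑ n ∈ range N, (f ((Z j ω (k + n)).1) - f ((Z j ω (k + n)).2))) R ω -
        m) ^ 2 ∂μ =
      μ[replicaSEsq (fun j ω => f ((Z j ω k).2) + ∑ n ∈ range N, (f ((Z j ω (k + n)).1) - f ((Z j ω (k + n)).2))) R] +
        (∫ z, (f ((z k).2) + ∑ n ∈ range N, (f ((z (k + n)).1) - f ((z (k + n)).2))) ∂P - m) ^ 2 := by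
  have hR0 : R ≠ 0 := by omega
  have hRne : (R : ℝ) ≠ 0 := by exact_mod_cast hR0
  have hHm : Measurable fun z : ℕ → Ω × Ω => f ((z k).2) + ∑ n ∈ range N, (f ((z (k + n)).1) - f ((z (k + n)).2)) :=
    measurable_crnLagEstimator hf k N
  have hY2 : ∀ j < R, MemLp (fun ω => f ((Z j ω k).2) + ∑ n ∈ range N, (f ((Z j ω (k + n)).1) - f ((Z j ω (k + n)).2))) 2 μ :=
    fun j _ => memLp_crnLag_replica hf ha hc k N hZm j
  have hmean : ∀ j < R, μ[fun ω => f ((Z j ω k).2) + ∑ n ∈ range N, (f ((Z j ω (k + n)).1) - f ((Z j ω (k + n)).2))] =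
      ∫ z, (f ((z k).2) + ∑ n ∈ range N, (f ((z (k + n)).1) - f ((z (k + n)).2))) ∂P := fun j hj =>
    integral_comp_eq_of_map_eq (hZm j) (hlaw j hj) hHm
  have hbar : μ[replicaMean (fun j ω => f ((Z j ω k).2) + ∑ n ∈ range N, (f ((Z j ω (k + n)).1) - f ((Z j ω (k + n)).2))) R] =
      ∫ z, (f ((z k).2) + ∑ n ∈ range N, (f ((z (k + n)).1) - f ((z (k + n)).2))) ∂P := by
    rw [integral_replicaMean hY2, Finset.sum_congr rfl fun j hj => hmean j (mem_range.1 hj), sum_const, card_range,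
      nsmul_eq_mul, mul_div_cancel_left₀ _ hRne]
  rw [integral_sub_const_sq (memLp_replicaMean hY2) m, hbar,
    crnLag_replicas_integral_SEsq_eq hR hf ha hc k N hZm hlaw hind]

/-! ## §2 The CRN pair chain from one initial coupling: honest up to the squared truncation bias -/

variable (ν : Measure (Ω × Ω)) [IsProbabilityMeasure ν]

/-- **THE PRINTED ERROR BAR IS HONEST UP TO THE SQUARED TRUNCATION BIAS.**  `w` measurable (a `Fact`), positive, normalised,
maximal at `x₀` (`r = 1 − 1/w(x₀)`); `K̂` a CRN pair kernel; `R ≥ 2` pairwise independent pair streams, each distributed as the pair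
chain from ONE initial coupling `ν̂` one update ahead in its first coordinate; `a ≤ f ≤ c` measurable.  Then
`E(H̄ − π f)² − E[SE²] ∈ [0, (r^{k+N}(c − a))²]`. [ours] -/
theorem crnLag_replicas_mse_sub_SEsq_mem_Icc [Fact (Measurable w)] (hw0 : ∀ y, 0 < w y) {x₀ : Ω} (hmax : ∀ y, w y ≤ w x₀)
    [IsProbabilityMeasure (q.withDensity fun y => ENNReal.ofReal (w y))]
    (Khat : Kernel (Ω × Ω) (Ω × Ω)) [IsMarkovKernel Khat]
    (hK : ∀ z : Ω × Ω, Khat z = (q.prod (volume : Measure unitInterval)).map (fun p : Ω × unitInterval =>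
      ((if (p.2 : ℝ) * w z.1 ≤ w p.1 then p.1 else z.1), (if (p.2 : ℝ) * w z.2 ≤ w p.1 then p.1 else z.2))))
    (hlag : ν.map Prod.fst = (ν.map Prod.snd).bind (indepMH q w))
    {f : Ω → ℝ} (hf : Measurable f) {a c : ℝ} (ha : ∀ x, a ≤ f x) (hc : ∀ x, f x ≤ c) (k N : ℕ) (hR : 2 ≤ R)
    (hZm : ∀ j, Measurable (Z j))
    (hlaw : ∀ j < R, μ.map (Z j) = Kernel.trajMeasure (X := fun _ : ℕ => Ω × Ω) ν
      (fun n : ℕ => Khat.comap (fun h : (i : ↥(Finset.Iic n)) → Ω × Ω => h ⟨n, Finset.mem_Iic.2 le_rfl⟩)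
        (measurable_pi_apply _)))
    (hind : ∀ i < R, ∀ j < R, i ≠ j → IndepFun (Z i) (Z j) μ) :
    ∫ ω, (replicaMean (fun j ω => f ((Z j ω k).2) + ∑ n ∈ range N, (f ((Z j ω (k + n)).1) - f ((Z j ω (k + n)).2))) R ω -
        ∫ x, f x ∂(q.withDensity fun y => ENNReal.ofReal (w y))) ^ 2 ∂μ -
      μ[replicaSEsq (fun j ω => f ((Z j ω k).2) + ∑ n ∈ range N, (f ((Z j ω (k + n)).1) - f ((Z j ω (k + n)).2))) R] ∈
      Set.Icc 0 (((1 - (w x₀)⁻¹) ^ (k + N) * (c - a)) ^ 2) := by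
  rw [crnLag_replicas_sq_eq_SEsq_add hR hf ha hc k N hZm hlaw hind, add_sub_cancel_left]
  have hb := crnLag_truncated_bias_abs_le hw0 hmax Khat hK ν hlag hf ha hc k N
  refine ⟨sq_nonneg _, ?_⟩
  rw [← sq_abs]
  exact pow_le_pow_left₀ (abs_nonneg _) hb 2

/-- **THE ERROR BAR SHRINKS LIKE `1/R` WITH THE EQUILIBRIUM CONSTANT**: `E[SE²] ≤ [Var_π f + r^k(c − a)²(2W² + W + 1)]/R` in the
setting of `crnLag_replicas_mse_sub_SEsq_mem_Icc` (no lag condition needed). [ours] -/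
theorem crnLag_replicas_integral_SEsq_le [Fact (Measurable w)] (hw0 : ∀ y, 0 < w y) {x₀ : Ω} (hmax : ∀ y, w y ≤ w x₀)
    [IsProbabilityMeasure (q.withDensity fun y => ENNReal.ofReal (w y))]
    (Khat : Kernel (Ω × Ω) (Ω × Ω)) [IsMarkovKernel Khat]
    (hK : ∀ z : Ω × Ω, Khat z = (q.prod (volume : Measure unitInterval)).map (fun p : Ω × unitInterval =>
      ((if (p.2 : ℝ) * w z.1 ≤ w p.1 then p.1 else z.1), (if (p.2 : ℝ) * w z.2 ≤ w p.1 then p.1 else z.2))))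
    {f : Ω → ℝ} (hf : Measurable f) {a c : ℝ} (ha : ∀ x, a ≤ f x) (hc : ∀ x, f x ≤ c) (k N : ℕ) (hR : 2 ≤ R)
    (hZm : ∀ j, Measurable (Z j))
    (hlaw : ∀ j < R, μ.map (Z j) = Kernel.trajMeasure (X := fun _ : ℕ => Ω × Ω) ν
      (fun n : ℕ => Khat.comap (fun h : (i : ↥(Finset.Iic n)) → Ω × Ω => h ⟨n, Finset.mem_Iic.2 le_rfl⟩)
        (measurable_pi_apply _)))
    (hind : ∀ i < R, ∀ j < R, i ≠ j → IndepFun (Z i) (Z j) μ) :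
    μ[replicaSEsq (fun j ω => f ((Z j ω k).2) + ∑ n ∈ range N, (f ((Z j ω (k + n)).1) - f ((Z j ω (k + n)).2))) R] ≤
      (∫ y, (f y - ∫ x, f x ∂(q.withDensity fun y => ENNReal.ofReal (w y))) ^ 2
          ∂(q.withDensity fun y => ENNReal.ofReal (w y)) +
        (1 - (w x₀)⁻¹) ^ k * (c - a) ^ 2 * (2 * w x₀ ^ 2 + w x₀ + 1)) / R := by
  have hR0 : R ≠ 0 := by omega
  have hRpos : (0 : ℝ) < R := by exact_mod_cast Nat.pos_of_ne_zero hR0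
  set m := ∫ x, f x ∂(q.withDensity fun y => ENNReal.ofReal (w y)) with hm
  set B := ∫ y, (f y - m) ^ 2 ∂(q.withDensity fun y => ENNReal.ofReal (w y)) +
    (1 - (w x₀)⁻¹) ^ k * (c - a) ^ 2 * (2 * w x₀ ^ 2 + w x₀ + 1) with hB
  have hHm : Measurable fun z : ℕ → Ω × Ω => f ((z k).2) + ∑ n ∈ range N, (f ((z (k + n)).1) - f ((z (k + n)).2)) :=
    measurable_crnLagEstimator hf k N
  have hY2 : ∀ j < R, MemLp (fun ω => f ((Z j ω k).2) + ∑ n ∈ range N, (f ((Z j ω (k + n)).1) - f ((Z j ω (k + n)).2))) 2 μ :=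
    fun j _ => memLp_crnLag_replica hf ha hc k N hZm j
  have hcov : ∀ i < R, ∀ j < R, i ≠ j →
      cov[fun ω => f ((Z i ω k).2) + ∑ n ∈ range N, (f ((Z i ω (k + n)).1) - f ((Z i ω (k + n)).2)),
        fun ω => f ((Z j ω k).2) + ∑ n ∈ range N, (f ((Z j ω (k + n)).1) - f ((Z j ω (k + n)).2)); μ] = 0 :=
    fun i hi j hj hij => ((hind i hi j hj hij).comp hHm hHm).covariance_eq_zero (hY2 i hi) (hY2 j hj)
  -- per replica: `Var(H_j) ≤ E(H_j − π f)² ≤ B`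
  have hvar : ∀ j ∈ range R,
      Var[fun ω => f ((Z j ω k).2) + ∑ n ∈ range N, (f ((Z j ω (k + n)).1) - f ((Z j ω (k + n)).2)); μ] ≤ B := by
    intro j hj
    have hj' := mem_range.1 hj
    have h1 := integral_sub_const_sq (hY2 j hj') m
    have h2 := crnLag_replica_sq_le hw0 hmax Khat hK hf ha hc k N (ν₀ := fun _ => ν) hZm (hlaw j hj')
    nlinarith [sq_nonneg (μ[fun ω => f ((Z j ω k).2) + ∑ n ∈ range N, (f ((Z j ω (k + n)).1) - f ((Z j ω (k + n)).2))] - m)]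
  rw [crnLag_replicas_integral_SEsq_eq hR hf ha hc k N hZm hlaw hind, variance_replicaMean hR0 hY2 hcov]
  calc (∑ j ∈ range R, Var[fun ω => f ((Z j ω k).2) + ∑ n ∈ range N, (f ((Z j ω (k + n)).1) - f ((Z j ω (k + n)).2)); μ]) /
        (R : ℝ) ^ 2 ≤ (∑ _j ∈ range R, B) / (R : ℝ) ^ 2 :=
        div_le_div_of_nonneg_right (sum_le_sum hvar) (by positivity)
    _ = B / R := by
        rw [sum_const, card_range, nsmul_eq_mul]
        field_simp

/-- **CHEBYSHEV WITH THE PRINTED ERROR BAR**: `P(|H̄ − π f| ≥ s) ≤ (E[SE²] + (r^{k+N}(c − a))²)/s²` for `s > 0`, in the setting of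
`crnLag_replicas_mse_sub_SEsq_mem_Icc`. [ours] -/
theorem crnLag_replicas_chebyshev [Fact (Measurable w)] (hw0 : ∀ y, 0 < w y) {x₀ : Ω} (hmax : ∀ y, w y ≤ w x₀)
    [IsProbabilityMeasure (q.withDensity fun y => ENNReal.ofReal (w y))]
    (Khat : Kernel (Ω × Ω) (Ω × Ω)) [IsMarkovKernel Khat]
    (hK : ∀ z : Ω × Ω, Khat z = (q.prod (volume : Measure unitInterval)).map (fun p : Ω × unitInterval =>
      ((if (p.2 : ℝ) * w z.1 ≤ w p.1 then p.1 else z.1), (if (p.2 : ℝ) * w z.2 ≤ w p.1 then p.1 else z.2))))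
    (hlag : ν.map Prod.fst = (ν.map Prod.snd).bind (indepMH q w))
    {f : Ω → ℝ} (hf : Measurable f) {a c : ℝ} (ha : ∀ x, a ≤ f x) (hc : ∀ x, f x ≤ c) (k N : ℕ) (hR : 2 ≤ R)
    (hZm : ∀ j, Measurable (Z j))
    (hlaw : ∀ j < R, μ.map (Z j) = Kernel.trajMeasure (X := fun _ : ℕ => Ω × Ω) ν
      (fun n : ℕ => Khat.comap (fun h : (i : ↥(Finset.Iic n)) → Ω × Ω => h ⟨n, Finset.mem_Iic.2 le_rfl⟩)
        (measurable_pi_apply _)))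
    (hind : ∀ i < R, ∀ j < R, i ≠ j → IndepFun (Z i) (Z j) μ) {s : ℝ} (hs : 0 < s) :
    μ.real {ω | s ≤ |replicaMean (fun j ω => f ((Z j ω k).2) + ∑ n ∈ range N, (f ((Z j ω (k + n)).1) - f ((Z j ω (k + n)).2)))
        R ω - ∫ x, f x ∂(q.withDensity fun y => ENNReal.ofReal (w y))|} ≤
      (μ[replicaSEsq (fun j ω => f ((Z j ω k).2) + ∑ n ∈ range N, (f ((Z j ω (k + n)).1) - f ((Z j ω (k + n)).2))) R] +
        ((1 - (w x₀)⁻¹) ^ (k + N) * (c - a)) ^ 2) / s ^ 2 := by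
  have hY2 : ∀ j < R, MemLp (fun ω => f ((Z j ω k).2) + ∑ n ∈ range N, (f ((Z j ω (k + n)).1) - f ((Z j ω (k + n)).2))) 2 μ :=
    fun j _ => memLp_crnLag_replica hf ha hc k N hZm j
  have hcheb := measureReal_abs_sub_ge_le (memLp_replicaMean hY2)
    (∫ x, f x ∂(q.withDensity fun y => ENNReal.ofReal (w y))) hs
  obtain ⟨-, h2⟩ := crnLag_replicas_mse_sub_SEsq_mem_Icc ν hw0 hmax Khat hK hlag hf ha hc k N hR hZm hlaw hind
  refine hcheb.trans (div_le_div_of_nonneg_right ?_ (sq_nonneg s))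
  linarith

/-! ## §3 Different initial couplings: the printed error bar is conservative, the bias allowance unchanged -/

variable {ν₀ : ℕ → Measure (Ω × Ω)} [∀ j, IsProbabilityMeasure (ν₀ j)]

omit [IsProbabilityMeasure ν] in
/-- **UNEQUAL STARTS**: `R ≥ 2` pairwise independent pair streams, `Z_j` distributed as the CRN pair chain from its own initial coupling
`ν̂_j` one update ahead in its first coordinate ⇒ `E(H̄ − π f)² ≤ E[SE²] + (r^{k+N}(c − a))²`. [ours] -/
theorem crnLag_replicas_mse_le_SEsq_add [Fact (Measurable w)] (hw0 : ∀ y, 0 < w y) {x₀ : Ω} (hmax : ∀ y, w y ≤ w x₀)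
    [IsProbabilityMeasure (q.withDensity fun y => ENNReal.ofReal (w y))]
    (Khat : Kernel (Ω × Ω) (Ω × Ω)) [IsMarkovKernel Khat]
    (hK : ∀ z : Ω × Ω, Khat z = (q.prod (volume : Measure unitInterval)).map (fun p : Ω × unitInterval =>
      ((if (p.2 : ℝ) * w z.1 ≤ w p.1 then p.1 else z.1), (if (p.2 : ℝ) * w z.2 ≤ w p.1 then p.1 else z.2))))
    {f : Ω → ℝ} (hf : Measurable f) {a c : ℝ} (ha : ∀ x, a ≤ f x) (hc : ∀ x, f x ≤ c) (k N : ℕ) (hR : 2 ≤ R)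
    (hZm : ∀ j, Measurable (Z j))
    (hlaw : ∀ j < R, μ.map (Z j) = Kernel.trajMeasure (X := fun _ : ℕ => Ω × Ω) (ν₀ j)
      (fun n : ℕ => Khat.comap (fun h : (i : ↥(Finset.Iic n)) → Ω × Ω => h ⟨n, Finset.mem_Iic.2 le_rfl⟩)
        (measurable_pi_apply _)))
    (hlag : ∀ j < R, (ν₀ j).map Prod.fst = ((ν₀ j).map Prod.snd).bind (indepMH q w))
    (hind : ∀ i < R, ∀ j < R, i ≠ j → IndepFun (Z i) (Z j) μ) :
    ∫ ω, (replicaMean (fun j ω => f ((Z j ω k).2) + ∑ n ∈ range N, (f ((Z j ω (k + n)).1) - f ((Z j ω (k + n)).2))) R ω -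
        ∫ x, f x ∂(q.withDensity fun y => ENNReal.ofReal (w y))) ^ 2 ∂μ ≤
      μ[replicaSEsq (fun j ω => f ((Z j ω k).2) + ∑ n ∈ range N, (f ((Z j ω (k + n)).1) - f ((Z j ω (k + n)).2))) R] +
        ((1 - (w x₀)⁻¹) ^ (k + N) * (c - a)) ^ 2 := by
  have hR0 : R ≠ 0 := by omega
  have hRpos : (0 : ℝ) < R := by exact_mod_cast Nat.pos_of_ne_zero hR0
  set m := ∫ x, f x ∂(q.withDensity fun y => ENNReal.ofReal (w y)) with hm
  set b := (1 - (w x₀)⁻¹) ^ (k + N) * (c - a) with hbdef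
  have hHm : Measurable fun z : ℕ → Ω × Ω => f ((z k).2) + ∑ n ∈ range N, (f ((z (k + n)).1) - f ((z (k + n)).2)) :=
    measurable_crnLagEstimator hf k N
  have hY2 : ∀ j < R, MemLp (fun ω => f ((Z j ω k).2) + ∑ n ∈ range N, (f ((Z j ω (k + n)).1) - f ((Z j ω (k + n)).2))) 2 μ :=
    fun j _ => memLp_crnLag_replica hf ha hc k N hZm j
  have hcov : ∀ i < R, ∀ j < R, i ≠ j →
      cov[fun ω => f ((Z i ω k).2) + ∑ n ∈ range N, (f ((Z i ω (k + n)).1) - f ((Z i ω (k + n)).2)),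
        fun ω => f ((Z j ω k).2) + ∑ n ∈ range N, (f ((Z j ω (k + n)).1) - f ((Z j ω (k + n)).2)); μ] = 0 :=
    fun i hi j hj hij => ((hind i hi j hj hij).comp hHm hHm).covariance_eq_zero (hY2 i hi) (hY2 j hj)
  have hb : ∀ j ∈ range R, |μ[fun ω => f ((Z j ω k).2) + ∑ n ∈ range N, (f ((Z j ω (k + n)).1) - f ((Z j ω (k + n)).2))] - m|
      ≤ b := fun j hj =>
    crnLag_replica_bias_abs_le hw0 hmax Khat hK hf ha hc k N hZm (hlaw j (mem_range.1 hj)) (hlag j (mem_range.1 hj))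
  -- the bias of the grand mean is an average of per-replica biases
  have hmeanbar : |μ[replicaMean (fun j ω => f ((Z j ω k).2) + ∑ n ∈ range N, (f ((Z j ω (k + n)).1) - f ((Z j ω (k + n)).2)))
      R] - m| ≤ b := by
    rw [integral_replicaMean hY2]
    have hrw : (∑ j ∈ range R, μ[fun ω => f ((Z j ω k).2) + ∑ n ∈ range N, (f ((Z j ω (k + n)).1) - f ((Z j ω (k + n)).2))]) /
        (R : ℝ) - m = (∑ j ∈ range R, (μ[fun ω => f ((Z j ω k).2) +
          ∑ n ∈ range N, (f ((Z j ω (k + n)).1) - f ((Z j ω (k + n)).2))] - m)) / R := by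
      rw [sum_sub_distrib, sum_const, card_range, nsmul_eq_mul]
      field_simp
    rw [hrw, abs_div, abs_of_pos hRpos, div_le_iff₀ hRpos]
    calc |∑ j ∈ range R, (μ[fun ω => f ((Z j ω k).2) + ∑ n ∈ range N, (f ((Z j ω (k + n)).1) - f ((Z j ω (k + n)).2))] - m)|
        ≤ ∑ j ∈ range R, |μ[fun ω => f ((Z j ω k).2) + ∑ n ∈ range N, (f ((Z j ω (k + n)).1) - f ((Z j ω (k + n)).2))] - m| :=
          abs_sum_le_sum_abs _ _
      _ ≤ ∑ _j ∈ range R, b := sum_le_sum hb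
      _ = b * R := by rw [sum_const, card_range, nsmul_eq_mul, mul_comm]
  have hvar := variance_replicaMean_le_integral_replicaSEsq hR hY2 hcov
  rw [integral_sub_const_sq (memLp_replicaMean hY2) m]
  have hsq : (μ[replicaMean (fun j ω => f ((Z j ω k).2) + ∑ n ∈ range N, (f ((Z j ω (k + n)).1) - f ((Z j ω (k + n)).2))) R] -
      m) ^ 2 ≤ b ^ 2 := by
    rw [← sq_abs]
    exact pow_le_pow_left₀ (abs_nonneg _) hmeanbar 2
  linarith

end Replicas

end Summit.Ventures.LatticeQCDFlow.Exactness

end
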